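import Mathlib
import Summits.Ventures.PercRepro2.SwOutJunctionH1Orbit
import Summits.Ventures.PercRepro2.SwOutJunctionH1Kinds
import Summits.Ventures.PercRepro2.SwOutJunctionH1BaseCore
import Summits.Ventures.PercRepro2.SwOutArmGTyped
import Summits.Ventures.PercRepro2.SwOutJunctionGTyped

/-!
# The (H1) single junction on the general doubly typed side, I: the sides and the kinds (O) and
(C) (blind cell PercRepro2, night-4 g33, 2026-08-28; proofs/NIGHT4-G33.md §3)

g13/g14's (H1) single-junction class for g7's general doubly typed side `gOutSide ends l h 𝓤 𝓓
𝓓″ X 𝓤′ U ξ` (= `gTypedQ ∩ outClass`) in place of the principal side `swOutSide`: the mark `o`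
of g13 is replaced by a set of EXEMPT vertices `F`, each FORCED INTO `C_R(l)` by the up-set `𝓤`
(`hF : ∀ x, F x → ∀ S ∈ 𝓤, x ∈ S` — the flavour of the mark `o ∈ C_R(l)`), every other vertex of
`U ∖ {h, u}` carries an outside edge or no edge, and the vertices of `X` inside `U` are isolated
(`hX`).  Every argument of g13's that used `o ∈ C_R(l)` is the same argument for an exempt
vertex (`mem_cluster_l_of_F_g`): the two sides of the extended hull are disjoint on the core kind
(`redExt_disjoint_blueExt_g`), so the canonical base is a core base (`coreBase_of_coreKind_g`) and
the point is a cube point of it (`coreReal_coreBaseOf_g`, through the core forms of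
SwOutJunctionH1BaseCore); a point with `u` outside the hull or escaping is core-free
(`coreFree_of_u_notMem_hull_g`, `coreFree_of_escaping_g`); kind (O) is g30's arm principle on the
general doubly typed side (`orbitKind_block_g`).  The vertices of `X` avoid every extended hull
inside `U` (`notMem_extHull_of_mem_X`).
-/

namespace Summit.Ventures.PercRepro2

namespace LocRows

open Hull

variable {V : Type*} {E : Type*} [Fintype E] [DecidableEq E]

open scoped Classical

variable {ends : E → Sym2 V} {U : Set V} {ξ : Config E} {l h u : V}
  {𝓤 𝓓 𝓓'' : Set (Set V)} {X : Set V} {𝓤' : Set (Set V)} {F : V → Prop}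

section Exempt

/-- An exempt vertex lies in the red cluster of `l` at every point of the general doubly typed
side. -/
lemma mem_cluster_l_of_F_g (hF : ∀ x, F x → ∀ S ∈ 𝓤, x ∈ S) {ζ : Config E}
    (hζ : ζ ∈ gOutSide ends l h 𝓤 𝓓 𝓓'' X 𝓤' U ξ) {x : V} (hx : F x) :
    x ∈ cluster ends ζ l :=
  hF x hx _ (mem_gTypedQ.1 (mem_gOutSide.1 hζ).1).2.1

/-- `h` is in neither cluster of `l` on the general doubly typed side. -/
lemma h_notMem_cluster_l_of_mem_gOutSide {ζ : Config E}
    (hζ : ζ ∈ gOutSide ends l h 𝓤 𝓓 𝓓'' X 𝓤' U ξ) :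
    h ∉ cluster ends ζ l ∧ h ∉ cluster ends (blue ζ) l := by
  have hh := (mem_gTypedQ.1 (mem_gOutSide.1 hζ).1).1
  exact ⟨fun h' => hh (Or.inl h'), fun h' => hh (Or.inr h')⟩

omit [Fintype E] [DecidableEq E] in
/-- A vertex with loops only lies in no cluster of another vertex. -/
lemma notMem_cluster_of_selfLoops {ζ : Config E} {v x : V} (hxv : x ≠ v)
    (hx : ∀ e, x ∈ ends e → ends e = s(x, x)) : x ∉ cluster ends ζ v := by
  intro hxc
  have key : x ∈ {y : V | y ≠ x} := by
    refine mem_of_conn_of_closed (ends := ends) (ω := ζ) ?_ hxv.symm hxc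
    intro y hy z hyz
    obtain ⟨hne, e, -, hends⟩ := openGraph_adj.1 hyz
    intro hzx
    subst hzx
    have := hx e (by rw [hends]; exact Sym2.mem_mk_right y z)
    rw [hends, Sym2.eq_iff] at this
    rcases this with ⟨h1, -⟩ | ⟨h1, -⟩ <;> exact hne h1
  exact key rfl

/-- g31's three-flavour exemption for `F ∨ X` (the only flavours used here: forced into `C_R(l)`,
or in `X`). -/
lemma hF_of_hF1' (hF : ∀ x, F x → ∀ S ∈ 𝓤, x ∈ S) :
    ∀ x, F x ∨ x ∈ X → (∀ S ∈ 𝓤, x ∈ S) ∨ (∀ S ∈ 𝓓'', x ∉ S) ∨ x ∈ X := by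
  rintro x (hx | hx)
  · exact Or.inl (hF x hx)
  · exact Or.inr (Or.inr hx)

omit [Fintype E] [DecidableEq E] in
/-- The exemption `F ∨ X` in g31's form. -/
lemma hout_of_hout (hout : ∀ x ∈ U, x ≠ h → x ≠ u →
      F x ∨ x ∈ X ∨ (∃ e y, ends e = s(x, y) ∧ y ∉ U) ∨ (∀ e, x ∉ ends e)) :
    ∀ x ∈ U, x ≠ h → x ≠ u →
      (F x ∨ x ∈ X) ∨ (∃ e y, ends e = s(x, y) ∧ y ∉ U) ∨ (∀ e, x ∉ ends e) := by
  intro x hxU hxh hxu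
  rcases hout x hxU hxh hxu with hf | hx | h' | h'
  · exact Or.inl (Or.inl hf)
  · exact Or.inl (Or.inr hx)
  · exact Or.inr (Or.inl h')
  · exact Or.inr (Or.inr h')

omit [Fintype E] [DecidableEq E] in
/-- A vertex of `U ∖ {h, u}` that is not exempt and lies in a cluster of `h` or of `u` carries an
outside edge (the vertices of `X` inside `U` carry loops only, so they lie in no cluster). -/
lemma exists_outEdge_of_mem_g
    (hout : ∀ x ∈ U, x ≠ h → x ≠ u →
      F x ∨ x ∈ X ∨ (∃ e y, ends e = s(x, y) ∧ y ∉ U) ∨ (∀ e, x ∉ ends e))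
    (hX : ∀ x ∈ X, x ∈ U → ∀ e, x ∈ ends e → ends e = s(x, x))
    {ζ : Config E} {x : V} (hxU : x ∈ U) (hxh : x ≠ h) (hxF : ¬ F x) (hxu : x ≠ u)
    (hx : x ∈ cluster ends ζ h ∨ x ∈ cluster ends ζ u) : ∃ e y, ends e = s(x, y) ∧ y ∉ U := by
  rcases hout x hxU hxh hxu with hf | hxX | h' | hiso
  · exact absurd hf hxF
  · exfalso
    rcases hx with hx | hx
    · exact notMem_cluster_of_selfLoops hxh (hX x hxX hxU) hx
    · exact notMem_cluster_of_selfLoops hxu (hX x hxX hxU) hx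
  · exact h'
  · exfalso
    rcases hx with hx | hx
    · obtain ⟨e, hxe⟩ := exists_edge_of_mem_cluster (h := h) hx hxh
      exact hiso e hxe
    · obtain ⟨e, hxe⟩ := exists_edge_of_mem_cluster (h := u) hx hxu
      exact hiso e hxe

omit [Fintype E] [DecidableEq E] in
/-- **The vertices of `X` avoid every extended hull inside `U`** (`h, u ∉ X`, the vertices of `X`
inside `U` carry loops only). -/
lemma notMem_extHull_of_mem_X (hhX : h ∉ X) (huX : u ∉ X)
    (hX : ∀ x ∈ X, x ∈ U → ∀ e, x ∈ ends e → ends e = s(x, x)) {ζ : Config E}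
    (hHU : extHull ends ζ h u ⊆ U) {x : V} (hx : x ∈ X) : x ∉ extHull ends ζ h u := by
  intro hxH
  have hxU : x ∈ U := hHU hxH
  have hxh : x ≠ h := fun h' => hhX (h' ▸ hx)
  have hxu : x ≠ u := fun h' => huX (h' ▸ hx)
  have hloops := hX x hx hxU
  rcases hxH with (hxh' | hxh') | (hxu' | hxu')
  · exact notMem_cluster_of_selfLoops hxh hloops hxh'
  · exact notMem_cluster_of_selfLoops hxh hloops hxh'
  · exact notMem_cluster_of_selfLoops hxu hloops hxu'
  · exact notMem_cluster_of_selfLoops hxu hloops hxu'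

end Exempt

section Sides

/-- **The two sides are disjoint** (the core kind, a point of the general doubly typed side):
a vertex of both sides carries an outside edge of a colour leading out of `U`, or is exempt — and
an exempt vertex is in `C_R(l)`, which meets neither `C_R(h)` nor `C_R(u)`. -/
theorem redExt_disjoint_blueExt_g (hl : l ∉ U) (hF : ∀ x, F x → ∀ S ∈ 𝓤, x ∈ S)
    (hout : ∀ x ∈ U, x ≠ h → x ≠ u →
      F x ∨ x ∈ X ∨ (∃ e y, ends e = s(x, y) ∧ y ∉ U) ∨ (∀ e, x ∉ ends e))
    (hX : ∀ x ∈ X, x ∈ U → ∀ e, x ∈ ends e → ends e = s(x, x))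
    {ζ : Config E} (hζ : ζ ∈ gOutSide ends l h 𝓤 𝓓 𝓓'' X 𝓤' U ξ) (hk : CoreKind ends U h u ζ)
    (x : V) (hxR : x ∈ redExt ends h u ζ) (hxB : x ∈ blueExt ends ζ h u) : False := by
  rw [mem_redExt_iff] at hxR
  rw [mem_blueExt_iff] at hxB
  obtain ⟨hxR, hxh, hxu⟩ := hxR
  obtain ⟨hxB, _, _⟩ := hxB
  have hcl := (mem_gOutSide.1 hζ).2
  have hhA : h ∉ cluster ends ζ l := (h_notMem_cluster_l_of_mem_gOutSide hζ).1
  -- `x ∈ U`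
  have hxU : x ∈ U := by
    rcases hxR with hx | hx
    · exact (mem_outClass.1 hcl).2 (Or.inl hx)
    · exact hk.2 (Or.inl hx)
  by_cases hxF : F x
  · -- an exempt vertex: `x ∈ C_R(l)` meets `C_R(h)` or `C_R(u)`
    have hxA : x ∈ cluster ends ζ l := mem_cluster_l_of_F_g hF hζ hxF
    rcases hxR with hx | hx
    · exact hhA (conn_trans hxA (conn_symm hx))
    · exact (u_notMem_cluster_l_of_coreKind hl hk).1 (conn_trans hxA (conn_symm hx))
  · obtain ⟨e, y, hxy, hyU⟩ := exists_outEdge_of_mem_g hout hX hxU hxh hxF hxu hxR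
    cases he : ζ e with
    | true =>
      rcases hxR with hx | hx
      · exact hyU ((mem_outClass.1 hcl).2 (Or.inl (mem_cluster_of_edge hx he hxy)))
      · exact hyU (hk.2 (Or.inl (mem_cluster_of_edge hx he hxy)))
    | false =>
      have he' : blue ζ e = true := by rw [blue_eq_true_iff]; exact he
      rcases hxB with hx | hx
      · exact hyU ((mem_outClass.1 hcl).2 (Or.inr (mem_cluster_of_edge hx he' hxy)))
      · exact hyU (hk.2 (Or.inr (mem_cluster_of_edge hx he' hxy)))

/-- The extended hull of a core-kind point of the side lies in `U`. -/
theorem extHull_subset_of_coreKind_g {ζ : Config E}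
    (hζ : ζ ∈ gOutSide ends l h 𝓤 𝓓 𝓓'' X 𝓤' U ξ) (hk : CoreKind ends U h u ζ) :
    extHull ends ζ h u ⊆ U := by
  rintro x (hx | hx)
  · exact (mem_outClass.1 (mem_gOutSide.1 hζ).2).2 hx
  · exact hk.2 hx

/-- **The canonical base of a core-kind point of the general doubly typed side is a core base on
its arms.** -/
theorem coreBase_of_coreKind_g (hl : l ∉ U) (hhu : h ≠ u) (hloop_h : ∀ e, ends e ≠ s(h, h))
    (hloop_u : ∀ e, ends e ≠ s(u, u)) (hnadj : ∀ e, ends e ≠ s(h, u))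
    (hF : ∀ x, F x → ∀ S ∈ 𝓤, x ∈ S)
    (hout : ∀ x ∈ U, x ≠ h → x ≠ u →
      F x ∨ x ∈ X ∨ (∃ e y, ends e = s(x, y) ∧ y ∉ U) ∨ (∀ e, x ∉ ends e))
    (hX : ∀ x ∈ X, x ∈ U → ∀ e, x ∈ ends e → ends e = s(x, x))
    (hH1 : H1 ends U h u) {ζ : Config E} (hζ : ζ ∈ gOutSide ends l h 𝓤 𝓓 𝓓'' X 𝓤' U ξ)
    (hk : CoreKind ends U h u ζ) :
    CoreBase ends (coreBaseOf ends ζ h u) h u (extHull ends ζ h u)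
      (fun P : armsC ends h u ζ => P.1) (fun P => pureC ends h P.1) :=
  coreBase_of_coreKind_core hhu hloop_h hloop_u hnadj hH1 hk
    (fun x hxR hxB => redExt_disjoint_blueExt_g hl hF hout hX hζ hk x hxR hxB)
    (extHull_subset_of_coreKind_g hζ hk)

/-- **A core-kind point of the general doubly typed side is the cube point of its canonical base
given by its red arms.** -/
theorem coreReal_coreBaseOf_g (hl : l ∉ U) (hhu : h ≠ u) (hF : ∀ x, F x → ∀ S ∈ 𝓤, x ∈ S)
    (hout : ∀ x ∈ U, x ≠ h → x ≠ u →
      F x ∨ x ∈ X ∨ (∃ e y, ends e = s(x, y) ∧ y ∉ U) ∨ (∀ e, x ∉ ends e))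
    (hX : ∀ x ∈ X, x ∈ U → ∀ e, x ∈ ends e → ends e = s(x, x))
    {ζ : Config E} (hζ : ζ ∈ gOutSide ends l h 𝓤 𝓓 𝓓'' X 𝓤' U ξ) (hk : CoreKind ends U h u ζ) :
    coreReal ends (fun P : armsC ends h u ζ => P.1) (coreBaseOf ends ζ h u) (omegaOf ends h u ζ) =
      ζ :=
  coreReal_coreBaseOf_core hhu
    (fun x hxR hxB => redExt_disjoint_blueExt_g hl hF hout hX hζ hk x hxR hxB)

end Sides

section Kinds

/-- A point of the general doubly typed side with `u` outside the hull of `h` is core-free. -/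
theorem coreFree_of_u_notMem_hull_g (hF : ∀ x, F x → ∀ S ∈ 𝓤, x ∈ S)
    (hout : ∀ x ∈ U, x ≠ h → x ≠ u →
      F x ∨ x ∈ X ∨ (∃ e y, ends e = s(x, y) ∧ y ∉ U) ∨ (∀ e, x ∉ ends e))
    {ζ : Config E} (hζ : ζ ∈ gOutSide ends l h 𝓤 𝓓 𝓓'' X 𝓤' U ξ) (hu : u ∉ hull ends ζ h) :
    CoreFree ends ζ h := by
  intro x hxT hxTp
  rcases core_eq_h_or_u_g (hF_of_hF1' hF) (hout_of_hout hout) hζ hxT hxTp with rfl | rfl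
  · rfl
  · exact absurd (Or.inl hxT) hu

/-- **An escaping point of the general doubly typed side is core-free.** -/
theorem coreFree_of_escaping_g (hF : ∀ x, F x → ∀ S ∈ 𝓤, x ∈ S)
    (hout : ∀ x ∈ U, x ≠ h → x ≠ u →
      F x ∨ x ∈ X ∨ (∃ e y, ends e = s(x, y) ∧ y ∉ U) ∨ (∀ e, x ∉ ends e))
    {ζ : Config E} (hζ : ζ ∈ gOutSide ends l h 𝓤 𝓓 𝓓'' X 𝓤' U ξ) (hesc : ¬ hull ends ζ u ⊆ U) :
    CoreFree ends ζ h := by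
  intro x hxT hxTp
  rcases core_eq_h_or_u_g (hF_of_hF1' hF) (hout_of_hout hout) hζ hxT hxTp with rfl | rfl
  · rfl
  · exfalso
    apply hesc
    exact (hull_u_subset_of_core hxT hxTp).trans (mem_outClass.1 (mem_gOutSide.1 hζ).2).2

/-- **Kind (O) of the partition, general doubly typed side**: the orbit of the all-red orientation
of a side point with `u` outside the hull contains it, consists of class configurations with `u`
outside the hull and the same all-red orientation, and satisfies the rigid inequality. -/
theorem orbitKind_block_g (h𝓤 : IsUpperSet 𝓤) (h𝓓 : IsLowerSet 𝓓) (h𝓓'' : IsLowerSet 𝓓'')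
    (h𝓤' : IsUpperSet 𝓤') (hl : l ∉ U) (hloop : ∀ e, ends e ≠ s(h, h))
    (hF : ∀ x, F x → ∀ S ∈ 𝓤, x ∈ S)
    (hout : ∀ x ∈ U, x ≠ h → x ≠ u →
      F x ∨ x ∈ X ∨ (∃ e y, ends e = s(x, y) ∧ y ∉ U) ∨ (∀ e, x ∉ ends e))
    {ζ : Config E} (hζ : ζ ∈ gOutSide ends l h 𝓤 𝓓 𝓓'' X 𝓤' U ξ) (hu : u ∉ hull ends ζ h) :
    ζ ∈ orbit ends (allRed ends ζ h) h ∧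
    (∀ ζ' ∈ orbit ends (allRed ends ζ h) h, ζ' ∈ gTypedQ ends l h 𝓤 𝓓 𝓓'' X 𝓤' →
      ζ' ∈ gOutSide ends l h 𝓤 𝓓 𝓓'' X 𝓤' U ξ ∧ u ∉ hull ends ζ' h ∧
        allRed ends ζ' h = allRed ends ζ h) ∧
    (∀ 𝓔 : Set (Set E), IsUpperSet 𝓔 →
      ((orbit ends (allRed ends ζ h) h).filter fun ζ' =>
          ζ' ∈ gTypedQ ends l h 𝓤 𝓓 𝓓'' X 𝓤' ∧ redEdges ends ζ' h ∈ 𝓔).card ≤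
        ((orbit ends (allRed ends ζ h) h).filter fun ζ' =>
          ζ' ∈ gTypedQ ends l h 𝓤 𝓓 𝓓'' X 𝓤' ∧ blueEdges ends ζ' h ∈ 𝓔).card) := by
  have hc : CoreFree ends ζ h := coreFree_of_u_notMem_hull_g hF hout hζ hu
  have hcl : ζ ∈ outClass ends U h ξ := (mem_gOutSide.1 hζ).2
  have hc₀ : CoreFree ends (allRed ends ζ h) h := coreFree_allRed hc
  have hcl₀ : allRed ends ζ h ∈ outClass ends U h ξ := allRed_mem_outClass hcl hc
  refine ⟨?_, ?_, ?_⟩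
  · obtain ⟨ω, hω⟩ := exists_orbitReal_eq hc rfl
    simp only [orbit, Finset.mem_image, Finset.mem_univ, true_and]
    exact ⟨ω, hω⟩
  · intro ζ' hζ' hQ
    simp only [orbit, Finset.mem_image, Finset.mem_univ, true_and] at hζ'
    obtain ⟨ω, rfl⟩ := hζ'
    refine ⟨mem_gOutSide.2 ⟨hQ, orbitReal_mem_outClass hc₀ hcl₀ ω⟩, ?_, ?_⟩
    · rw [hull_orbitReal hc₀, hull_allRed hc]; exact hu
    · rw [allRed_orbitReal hc₀, allRed_idem hc]
  · intro 𝓔 h𝓔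
    exact card_orbit_le_g hc₀ hloop h𝓤 h𝓓 h𝓓'' h𝓤' hcl₀ hl h𝓔

end Kinds

end LocRows

end Summit.Ventures.PercRepro2
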